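import Summits.CriticalPhenomena.PercolationContinuityZ3.Theorems.PercNearOneGluingNoHeavyLowerTailFrontierDecRowsClusterBHK3Defs
import Literature.Probability.Percolation.TwoSetExchange
import Literature.Probability.Percolation.PercolationEvents
import Literature.Probability.LatticeModels.ProdBernoulliIndependence
import HarnessLib

/-!
# `NoHeavyLowerTail` (stmt-CriticalPhenomena-4575) — BHK's Theorem 1.1 CONDITIONED ON `{X ~ Y}` ("W-BHK"), and the set form of the row dR3

Support file (prover prim-gen-kcluster gen 46; `--supports stmt-CriticalPhenomena-4575`).  No named facts, no sorries, no definitions.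

Setting: bond percolation with arbitrary edge probabilities `w` on a finite vertex type (`μ = prodBernoulli w`), vertex sets
`S, X, Y`, `C_S ω = ⋃_{s ∈ S} C_s ω` the union of BHK's open edge clusters, `D_X = {S ↮ X}`, `D_Y = {S ↮ Y}`.
Van den Berg–Häggström–Kahn's Theorem 1.1 (`P(𝒜, S ↮ X) P(ℬ, S ↮ Y) ≤ P(𝒜 ℬ, S ↮ X ∩ Y) P(S ↮ X ∪ Y)` for increasing
events `𝒜, ℬ` of `C_S`) is, for DISJOINT `X, Y`, four applications of Harris' inequality (their base case).  The theorem of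
this file is that the disjoint case survives conditioning on the connection `W = {X ~ Y}` of the two avoidance sets — where the
conditional measure is no longer a product measure:

* `condBHK` — for events `𝒜, ℬ` closed under enlarging `C_S` and an event `W` closed under enlarging `C_X` and under enlarging
  `C_Y` (e.g. `W = {X ~ Y}`, `condBHK_conn`):
  `μ(W ∩ 𝒜 ∩ D_X) · μ(W ∩ ℬ ∩ D_Y) ≤ μ(W ∩ 𝒜 ∩ ℬ) · μ(W ∩ D_X ∩ D_Y)`.
  Proof (KCLUSTER-gen44 §3): BHK's two-cluster Theorem 1.4 with sets (tree: `setTwoClusterExchange`) three times —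
  `P(W | 𝒜, D_X) ≤ P(W | D_X)`, `P(W | ℬ, D_Y) ≤ P(W | D_Y)`, and "given `D_Y`, `W` and `D_X` are positively correlated" — chained
  with six Harris inequalities (`prodBernoulli_harris*`) and multiplied out (`chain_real`).
* `negCorr_of_condBHK` — the first link alone: `μ(W ∩ 𝒜 ∩ D_X) ≤ μ(W) · μ(𝒜 ∩ D_X)`; and `condDR4` —
  `μ(W ∩ 𝒜 ∩ D_X) · μ(ℰ) ≤ μ(𝒜 ∩ D_X) · μ(W ∩ ℰ)` for every increasing `ℰ` (the set form of the row dR4⁺ of part VII).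
* `posCorr_conn_sets` — **for arbitrary vertex sets `S, X, Y`: conditionally on `{X ~ Y}`, the events `{S ~ X}` and `{S ~ Y}` are
  positively correlated**, `μ(W ∩ {S~X}) · μ(W ∩ {S~Y}) ≤ μ(W) · μ(W ∩ {S~X} ∩ {S~Y})` (and the four-cell form `dualRowR3_sets`).
  This is the set form dR3* of the kernel row dR3 (`PivotalBHK.dualRowR3_PrW`, `posCorr_prodBernoulli`: given `{a ~ b off c}`,
  `{a ~ c off b}` and `{b ~ c off a}` are positively correlated), conjectured in KCLUSTER-gen43 §0.4/§2b and proved on paper in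
  KCLUSTER-gen44 §3; contrast van den Berg–Kahn (2001), Remark after Thm. 1.1: given `{s ~ t}`, `{s ~ a}` and `{s ~ b}` need NOT be
  positively correlated — there the conditioning is on a connection of the source, here on the connection of the two targets.
[cite: VandenbergHaggstromKahn2005, Thm. 1.4 (p. 7), Thm. 2.1 (p. 9) at q = 1, Remark 1 after Thm. 1.2 (p. 5); Thm. 1.1 (p. 3)]
-/

noncomputable section

namespace Summit.CriticalPhenomena.PercolationContinuityZ3.Theorems

namespace ConditionedBHK

open MeasureTheory Set Literature.Probability.Percolation Literature.Probability.LatticeModels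
open Literature.Probability.Percolation.TwoSetExchange

variable {V : Type*}

/-! ### Monotonicity bookkeeping (events closed under enlarging `C_S` are up-sets: `FrontierDecRows.isUpperSet_of_clusterMono`) -/

/-- `{S ↮ X}` is decreasing. [folklore] -/
theorem isLowerSet_notConn (S X : Set V) :
    IsLowerSet {ω : BondConfig V | ∀ s ∈ S, ∀ x ∈ X, ¬ (openGraph ω).Reachable s x} :=
  fun _ _ h hω s hs x hx hr => hω s hs x hx (isUpperSet_openConn s x h hr)

/-- `{S ↮ X}` is closed under shrinking `C_S` (type `(−)`). [folklore] -/
theorem notConn_closed (S X : Set V) ⦃ω ω' : BondConfig V⦄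
    (hs : (⋃ s ∈ S, openEdgeCluster ω' s) ⊆ (⋃ s ∈ S, openEdgeCluster ω s))
    (hω : ω ∈ {ω : BondConfig V | ∀ s ∈ S, ∀ x ∈ X, ¬ (openGraph ω).Reachable s x}) :
    ω' ∈ {ω : BondConfig V | ∀ s ∈ S, ∀ x ∈ X, ¬ (openGraph ω).Reachable s x} := by
  intro s hs' x hx hr
  have h1 : ω ∈ (openConn s x : Set (BondConfig V))ᶜ := fun h => hω s hs' x hx h
  exact typeMinus_not_openConn_of_mem S (∅ : Set V) hs' x hs (by simp) h1 hr

/-- `{x₀ ↔ y}` for `x₀ ∈ X` is closed under enlarging `C_X`. [folklore] -/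
theorem openConn_closed_left (X : Set V) {x₀ : V} (hx₀ : x₀ ∈ X) (y : V) ⦃ω ω' : BondConfig V⦄
    (h : (⋃ x ∈ X, openEdgeCluster ω x) ⊆ (⋃ x ∈ X, openEdgeCluster ω' x))
    (hω : ω ∈ (openConn x₀ y : Set (BondConfig V))) : ω' ∈ (openConn x₀ y : Set (BondConfig V)) :=
  typePlus_openConn_of_mem X (∅ : Set V) hx₀ y h (by simp) hω

/-- `{X ~ Y} = ⋃_{x ∈ X, y ∈ Y} {x ↔ y}` is closed under enlarging `C_X`. [folklore] -/
theorem conn_closed_left (X Y : Set V) ⦃ω ω' : BondConfig V⦄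
    (h : (⋃ x ∈ X, openEdgeCluster ω x) ⊆ (⋃ x ∈ X, openEdgeCluster ω' x))
    (hω : ω ∈ ⋃ x ∈ X, ⋃ y ∈ Y, (openConn x y : Set (BondConfig V))) :
    ω' ∈ ⋃ x ∈ X, ⋃ y ∈ Y, (openConn x y : Set (BondConfig V)) := by
  obtain ⟨x, hx, hω'⟩ := mem_iUnion₂.1 hω
  obtain ⟨y, hy, hxy⟩ := mem_iUnion₂.1 hω'
  exact mem_biUnion hx (mem_biUnion hy (openConn_closed_left X hx y h hxy))

/-- `{X ~ Y}` is closed under enlarging `C_Y`. [folklore] -/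
theorem conn_closed_right (X Y : Set V) ⦃ω ω' : BondConfig V⦄
    (h : (⋃ y ∈ Y, openEdgeCluster ω y) ⊆ (⋃ y ∈ Y, openEdgeCluster ω' y))
    (hω : ω ∈ ⋃ x ∈ X, ⋃ y ∈ Y, (openConn x y : Set (BondConfig V))) :
    ω' ∈ ⋃ x ∈ X, ⋃ y ∈ Y, (openConn x y : Set (BondConfig V)) := by
  obtain ⟨x, hx, hω'⟩ := mem_iUnion₂.1 hω
  obtain ⟨y, hy, hxy⟩ := mem_iUnion₂.1 hω'
  have h1 : ω ∈ (openConn y x : Set (BondConfig V)) := SimpleGraph.Reachable.symm hxy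
  have h2 : ω' ∈ (openConn y x : Set (BondConfig V)) := openConn_closed_left Y hy x h h1
  exact mem_biUnion hx (mem_biUnion hy (SimpleGraph.Reachable.symm h2))

/-- `{S ~ X}ᶜ = {S ↮ X}`. [folklore] -/
theorem compl_conn_eq (S X : Set V) :
    (⋃ s ∈ S, ⋃ x ∈ X, (openConn s x : Set (BondConfig V)))ᶜ =
      {ω : BondConfig V | ∀ s ∈ S, ∀ x ∈ X, ¬ (openGraph ω).Reachable s x} := by
  ext ω
  simp only [mem_compl_iff, mem_iUnion, mem_setOf_eq, not_exists, exists_prop, not_and]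
  rfl

/-! ### The real-number chain -/

/-- The bookkeeping of the chain `P(D_X)P(D_Y)·L₁L₂ ≤ [a·w_X][b·w_Y] ≤ … ≤ R₁R₂·P(D_X)P(D_Y)`, division-free, with the degenerate
cases `P(D_X) = 0` / `P(D_Y) = 0`. [this work] -/
theorem chain_real {L1 L2 dX dY a b wX wY pA pB pAB dXY pW R1 R2 : ℝ}
    (hL1 : 0 ≤ L1) (hL2 : 0 ≤ L2) (hdX : 0 ≤ dX) (hdY : 0 ≤ dY) (ha : 0 ≤ a) (hb : 0 ≤ b) (hwX : 0 ≤ wX) (hwY : 0 ≤ wY)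
    (hpA : 0 ≤ pA) (hpB : 0 ≤ pB) (hR1 : 0 ≤ R1) (hR2 : 0 ≤ R2)
    (hL1d : L1 ≤ dX) (hL2d : L2 ≤ dY)
    (h1 : L1 * dX ≤ a * wX) (h2 : L2 * dY ≤ b * wY)
    (h3a : a ≤ pA * dX) (h3b : b ≤ pB * dY) (h3c : pA * pB ≤ pAB) (h3d : dX * dY ≤ dXY)
    (h4a : wX ≤ pW * dX) (h4b : pW * pAB ≤ R1)
    (h5 : dXY * wY ≤ dY * R2) :
    L1 * L2 ≤ R1 * R2 := by
  rcases eq_or_lt_of_le hdX with hdX0 | hdXp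
  · have : L1 = 0 := le_antisymm (hdX0 ▸ hL1d) hL1
    rw [this, zero_mul]; exact mul_nonneg hR1 hR2
  rcases eq_or_lt_of_le hdY with hdY0 | hdYp
  · have : L2 = 0 := le_antisymm (hdY0 ▸ hL2d) hL2
    rw [this, mul_zero]; exact mul_nonneg hR1 hR2
  -- `a·b ≤ pAB·dX·dY`
  have h6 : a * b ≤ pAB * (dX * dY) := by
    calc a * b ≤ (pA * dX) * (pB * dY) := mul_le_mul h3a h3b hb (mul_nonneg hpA hdX)
      _ = (pA * pB) * (dX * dY) := by ring
      _ ≤ pAB * (dX * dY) := mul_le_mul_of_nonneg_right h3c (mul_nonneg hdX hdY)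
  have hpAB : 0 ≤ pAB := le_trans (mul_nonneg hpA hpB) h3c
  -- `dX·wY ≤ R2`
  have h7 : dX * wY ≤ R2 := by
    have : (dX * wY) * dY ≤ R2 * dY := by
      calc (dX * wY) * dY = (dX * dY) * wY := by ring
        _ ≤ dXY * wY := mul_le_mul_of_nonneg_right h3d hwY
        _ ≤ dY * R2 := h5
        _ = R2 * dY := by ring
    exact le_of_mul_le_mul_right this hdYp
  -- the chain
  have h8 : (L1 * L2) * (dX * dY) ≤ (R1 * R2) * (dX * dY) := by
    calc (L1 * L2) * (dX * dY) = (L1 * dX) * (L2 * dY) := by ring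
      _ ≤ (a * wX) * (b * wY) := mul_le_mul h1 h2 (mul_nonneg hL2 hdY) (mul_nonneg ha hwX)
      _ = (a * b) * (wX * wY) := by ring
      _ ≤ (pAB * (dX * dY)) * (wX * wY) := mul_le_mul_of_nonneg_right h6 (mul_nonneg hwX hwY)
      _ = (pAB * dY * wY) * (dX * wX) := by ring
      _ ≤ (pAB * dY * wY) * (dX * (pW * dX)) :=
          mul_le_mul_of_nonneg_left (mul_le_mul_of_nonneg_left h4a hdX) (mul_nonneg (mul_nonneg hpAB hdY) hwY)
      _ = (pW * pAB) * (dX * wY) * (dX * dY) := by ring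
      _ ≤ R1 * R2 * (dX * dY) := by
          refine mul_le_mul_of_nonneg_right ?_ (mul_nonneg hdX hdY)
          exact mul_le_mul h4b h7 (mul_nonneg hdX hwY) hR1
  exact le_of_mul_le_mul_right h8 (mul_pos hdXp hdYp)

/-! ### W-BHK -/

section Main

variable [Fintype V] (w : Sym2 V → unitInterval) (S X Y : Set V)

/-- **BHK's Theorem 1.4 with sets, event form** (from the tree's `setTwoClusterExchange`): for `A` closed under enlarging `C_S`
and `B` closed under enlarging `C_T`, with `D = {S ↮ T}`: `μ(D ∩ (A ∩ B)) · μ(D) ≤ μ(D ∩ A) · μ(D ∩ B)` — given `{S ↮ T}` an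
increasing event of `C_S` and an increasing event of `C_T` are negatively correlated.
[cite: VandenbergHaggstromKahn2005, Thm. 1.4 (p. 7) with Remark 1 after Thm. 1.2 (p. 5) — corollary of the tree's set form] -/
theorem negCorr_sets (T : Set V) {A B : Set (BondConfig V)}
    (hA : ∀ ⦃ω ω' : BondConfig V⦄, (⋃ s ∈ S, openEdgeCluster ω s) ⊆ (⋃ s ∈ S, openEdgeCluster ω' s) → ω ∈ A → ω' ∈ A)
    (hB : ∀ ⦃ω ω' : BondConfig V⦄, (⋃ t ∈ T, openEdgeCluster ω t) ⊆ (⋃ t ∈ T, openEdgeCluster ω' t) → ω ∈ B → ω' ∈ B) :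
    (prodBernoulli w).real ({ω : BondConfig V | ∀ s ∈ S, ∀ t ∈ T, ¬ (openGraph ω).Reachable s t} ∩ (A ∩ B)) *
        (prodBernoulli w).real {ω : BondConfig V | ∀ s ∈ S, ∀ t ∈ T, ¬ (openGraph ω).Reachable s t} ≤
      (prodBernoulli w).real ({ω : BondConfig V | ∀ s ∈ S, ∀ t ∈ T, ¬ (openGraph ω).Reachable s t} ∩ A) *
        (prodBernoulli w).real ({ω : BondConfig V | ∀ s ∈ S, ∀ t ∈ T, ¬ (openGraph ω).Reachable s t} ∩ B) := by
  have key := setTwoClusterExchange w S T (A₁ := A) (A₂ := univ) (B₁ := B) (B₂ := univ)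
    (fun _ _ h1 _ hω => hA h1 hω) (fun _ _ _ _ _ => mem_univ _)
    (fun _ _ _ h2 hω => hB h2 hω) (fun _ _ _ _ _ => mem_univ _)
  simpa only [inter_univ, univ_inter] using key

/-- **Given `{S ↮ T}`, `{S ↮ X}` and any increasing event of `C_T` are positively correlated** (Theorem 1.4 with sets for the
decreasing `C_S`-event `{S ↮ X}`): `μ(D ∩ {S↮X}) · μ(D ∩ B) ≤ μ(D) · μ(D ∩ ({S↮X} ∩ B))`, `D = {S ↮ T}`.
[cite: VandenbergHaggstromKahn2005, Thm. 1.4 (p. 7) with Remark 1 after Thm. 1.2 (p. 5) — corollary of the tree's set form] -/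
theorem posCorr_notConn_sets (T : Set V) {B : Set (BondConfig V)}
    (hB : ∀ ⦃ω ω' : BondConfig V⦄, (⋃ t ∈ T, openEdgeCluster ω t) ⊆ (⋃ t ∈ T, openEdgeCluster ω' t) → ω ∈ B → ω' ∈ B) :
    (prodBernoulli w).real ({ω : BondConfig V | ∀ s ∈ S, ∀ t ∈ T, ¬ (openGraph ω).Reachable s t} ∩
          {ω : BondConfig V | ∀ s ∈ S, ∀ x ∈ X, ¬ (openGraph ω).Reachable s x}) *
        (prodBernoulli w).real ({ω : BondConfig V | ∀ s ∈ S, ∀ t ∈ T, ¬ (openGraph ω).Reachable s t} ∩ B) ≤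
      (prodBernoulli w).real {ω : BondConfig V | ∀ s ∈ S, ∀ t ∈ T, ¬ (openGraph ω).Reachable s t} *
        (prodBernoulli w).real ({ω : BondConfig V | ∀ s ∈ S, ∀ t ∈ T, ¬ (openGraph ω).Reachable s t} ∩
          ({ω : BondConfig V | ∀ s ∈ S, ∀ x ∈ X, ¬ (openGraph ω).Reachable s x} ∩ B)) := by
  have key := setTwoClusterExchange w S T (A₁ := univ) (A₂ := univ)
    (B₁ := {ω : BondConfig V | ∀ s ∈ S, ∀ x ∈ X, ¬ (openGraph ω).Reachable s x}) (B₂ := B)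
    (fun _ _ _ _ _ => mem_univ _) (fun _ _ _ _ _ => mem_univ _)
    (fun _ _ h1 _ hω => notConn_closed S X h1 hω) (fun _ _ _ h2 hω => hB h2 hω)
  simpa only [inter_univ, univ_inter] using key

/-- **W-BHK: van den Berg–Häggström–Kahn's Theorem 1.1 conditioned on the connection of the two avoidance sets.**  For vertex sets
`S, X, Y`, events `𝒜, ℬ` closed under enlarging `C_S = ⋃_{s∈S} C_s`, and an event `W` closed under enlarging `C_X` and under
enlarging `C_Y` (the case in point: `W = {X ~ Y}`), with `D_X = {S ↮ X}`, `D_Y = {S ↮ Y}` and `μ = prodBernoulli w`: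
`μ(D_X ∩ (𝒜 ∩ W)) · μ(D_Y ∩ (ℬ ∩ W)) ≤ μ(W ∩ (𝒜 ∩ ℬ)) · μ(D_Y ∩ (D_X ∩ W))`.
Without `W` (or for `X ∩ Y ≠ ∅`, when `{X ~ Y}` is everything) this is four Harris inequalities — the base case of BHK's
Thm. 1.1; with `W` the conditional measure is not a product measure and the proof chains BHK's Thm. 1.4 (sets) three times with
Harris six times (`chain_real`).  Paper proof: KCLUSTER-gen44 §3 (this lineage). [this work] -/
theorem condBHK {𝒜 ℬ W : Set (BondConfig V)}
    (h𝒜 : ∀ ⦃ω ω' : BondConfig V⦄, (⋃ s ∈ S, openEdgeCluster ω s) ⊆ (⋃ s ∈ S, openEdgeCluster ω' s) → ω ∈ 𝒜 → ω' ∈ 𝒜)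
    (hℬ : ∀ ⦃ω ω' : BondConfig V⦄, (⋃ s ∈ S, openEdgeCluster ω s) ⊆ (⋃ s ∈ S, openEdgeCluster ω' s) → ω ∈ ℬ → ω' ∈ ℬ)
    (hWX : ∀ ⦃ω ω' : BondConfig V⦄, (⋃ x ∈ X, openEdgeCluster ω x) ⊆ (⋃ x ∈ X, openEdgeCluster ω' x) → ω ∈ W → ω' ∈ W)
    (hWY : ∀ ⦃ω ω' : BondConfig V⦄, (⋃ y ∈ Y, openEdgeCluster ω y) ⊆ (⋃ y ∈ Y, openEdgeCluster ω' y) → ω ∈ W → ω' ∈ W) :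
    (prodBernoulli w).real ({ω : BondConfig V | ∀ s ∈ S, ∀ x ∈ X, ¬ (openGraph ω).Reachable s x} ∩ (𝒜 ∩ W)) *
        (prodBernoulli w).real ({ω : BondConfig V | ∀ s ∈ S, ∀ y ∈ Y, ¬ (openGraph ω).Reachable s y} ∩ (ℬ ∩ W)) ≤
      (prodBernoulli w).real (W ∩ (𝒜 ∩ ℬ)) *
        (prodBernoulli w).real ({ω : BondConfig V | ∀ s ∈ S, ∀ y ∈ Y, ¬ (openGraph ω).Reachable s y} ∩
          ({ω : BondConfig V | ∀ s ∈ S, ∀ x ∈ X, ¬ (openGraph ω).Reachable s x} ∩ W)) := by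
  set μ := prodBernoulli w with hμ
  set DX : Set (BondConfig V) := {ω | ∀ s ∈ S, ∀ x ∈ X, ¬ (openGraph ω).Reachable s x} with hDX
  set DY : Set (BondConfig V) := {ω | ∀ s ∈ S, ∀ y ∈ Y, ¬ (openGraph ω).Reachable s y} with hDY
  -- monotonicity and measurability
  have u𝒜 : IsUpperSet 𝒜 := FrontierDecRows.isUpperSet_of_clusterMono S h𝒜
  have uℬ : IsUpperSet ℬ := FrontierDecRows.isUpperSet_of_clusterMono S hℬ
  have uW : IsUpperSet W := FrontierDecRows.isUpperSet_of_clusterMono X hWX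
  have lX : IsLowerSet DX := isLowerSet_notConn S X
  have lY : IsLowerSet DY := isLowerSet_notConn S Y
  have m : ∀ A : Set (BondConfig V), MeasurableSet A := fun _ => MeasurableSet.of_discrete
  -- (1), (2): Theorem 1.4 with sets
  have h1 : μ.real (DX ∩ (𝒜 ∩ W)) * μ.real DX ≤ μ.real (DX ∩ 𝒜) * μ.real (DX ∩ W) :=
    negCorr_sets w S X h𝒜 hWX
  have h2 : μ.real (DY ∩ (ℬ ∩ W)) * μ.real DY ≤ μ.real (DY ∩ ℬ) * μ.real (DY ∩ W) :=
    negCorr_sets w S Y hℬ hWY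
  -- (3), (4): Harris
  have h3a : μ.real (DX ∩ 𝒜) ≤ μ.real 𝒜 * μ.real DX := by
    rw [inter_comm]; exact prodBernoulli_harris_upper_lower w u𝒜 lX (m _) (m _)
  have h3b : μ.real (DY ∩ ℬ) ≤ μ.real ℬ * μ.real DY := by
    rw [inter_comm]; exact prodBernoulli_harris_upper_lower w uℬ lY (m _) (m _)
  have h3c : μ.real 𝒜 * μ.real ℬ ≤ μ.real (𝒜 ∩ ℬ) := prodBernoulli_harris w u𝒜 uℬ (m _) (m _)
  have h3d : μ.real DX * μ.real DY ≤ μ.real (DX ∩ DY) := prodBernoulli_harris_lower w lX lY (m _) (m _)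
  have h4a : μ.real (DX ∩ W) ≤ μ.real W * μ.real DX := by
    rw [inter_comm]; exact prodBernoulli_harris_upper_lower w uW lX (m _) (m _)
  have h4b : μ.real W * μ.real (𝒜 ∩ ℬ) ≤ μ.real (W ∩ (𝒜 ∩ ℬ)) := prodBernoulli_harris w uW (u𝒜.inter uℬ) (m _) (m _)
  -- (5): given `D_Y`, `W` and `D_X` are positively correlated
  have h5 : μ.real (DX ∩ DY) * μ.real (DY ∩ W) ≤ μ.real DY * μ.real (DY ∩ (DX ∩ W)) := by
    have := posCorr_notConn_sets w S X Y hWY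
    rw [inter_comm DY DX] at this
    exact this
  -- sizes
  have hL1d : μ.real (DX ∩ (𝒜 ∩ W)) ≤ μ.real DX := measureReal_mono inter_subset_left
  have hL2d : μ.real (DY ∩ (ℬ ∩ W)) ≤ μ.real DY := measureReal_mono inter_subset_left
  exact chain_real measureReal_nonneg measureReal_nonneg measureReal_nonneg measureReal_nonneg measureReal_nonneg
    measureReal_nonneg measureReal_nonneg measureReal_nonneg measureReal_nonneg measureReal_nonneg measureReal_nonneg
    measureReal_nonneg hL1d hL2d h1 h2 h3a h3b h3c h3d h4a h4b h5

/-- **W-BHK for `W = {X ~ Y}`**: `μ({S↮X} ∩ (𝒜 ∩ {X~Y})) · μ({S↮Y} ∩ (ℬ ∩ {X~Y})) ≤ μ({X~Y} ∩ (𝒜 ∩ ℬ)) · μ({S↮Y} ∩ ({S↮X} ∩ {X~Y}))`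
for `𝒜, ℬ` closed under enlarging `C_S`, where `{X ~ Y} = ⋃_{x ∈ X, y ∈ Y} {x ↔ y}`. [this work] -/
theorem condBHK_conn {𝒜 ℬ : Set (BondConfig V)}
    (h𝒜 : ∀ ⦃ω ω' : BondConfig V⦄, (⋃ s ∈ S, openEdgeCluster ω s) ⊆ (⋃ s ∈ S, openEdgeCluster ω' s) → ω ∈ 𝒜 → ω' ∈ 𝒜)
    (hℬ : ∀ ⦃ω ω' : BondConfig V⦄, (⋃ s ∈ S, openEdgeCluster ω s) ⊆ (⋃ s ∈ S, openEdgeCluster ω' s) → ω ∈ ℬ → ω' ∈ ℬ) :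
    (prodBernoulli w).real ({ω : BondConfig V | ∀ s ∈ S, ∀ x ∈ X, ¬ (openGraph ω).Reachable s x} ∩
          (𝒜 ∩ ⋃ x ∈ X, ⋃ y ∈ Y, openConn x y)) *
        (prodBernoulli w).real ({ω : BondConfig V | ∀ s ∈ S, ∀ y ∈ Y, ¬ (openGraph ω).Reachable s y} ∩
          (ℬ ∩ ⋃ x ∈ X, ⋃ y ∈ Y, openConn x y)) ≤
      (prodBernoulli w).real ((⋃ x ∈ X, ⋃ y ∈ Y, openConn x y) ∩ (𝒜 ∩ ℬ)) *
        (prodBernoulli w).real ({ω : BondConfig V | ∀ s ∈ S, ∀ y ∈ Y, ¬ (openGraph ω).Reachable s y} ∩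
          ({ω : BondConfig V | ∀ s ∈ S, ∀ x ∈ X, ¬ (openGraph ω).Reachable s x} ∩ ⋃ x ∈ X, ⋃ y ∈ Y, openConn x y)) :=
  condBHK w S X Y h𝒜 hℬ (conn_closed_left X Y) (conn_closed_right X Y)

/-! ### The first link alone: `P(W | 𝒜, S ↮ X) ≤ P(W) ≤ P(W | ℰ)` (set form of dR4⁺) -/

/-- **`W` is negatively correlated with `𝒜 ∩ {S ↮ X}`**: for `𝒜` closed under enlarging `C_S` and `W` closed under enlarging
`C_X`, `μ({S↮X} ∩ (𝒜 ∩ W)) ≤ μ(W) · μ({S↮X} ∩ 𝒜)` (Theorem 1.4 with sets, then Harris for `W` and `{S ↮ X}`). [this work] -/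
theorem negCorr_of_condBHK {𝒜 W : Set (BondConfig V)}
    (h𝒜 : ∀ ⦃ω ω' : BondConfig V⦄, (⋃ s ∈ S, openEdgeCluster ω s) ⊆ (⋃ s ∈ S, openEdgeCluster ω' s) → ω ∈ 𝒜 → ω' ∈ 𝒜)
    (hWX : ∀ ⦃ω ω' : BondConfig V⦄, (⋃ x ∈ X, openEdgeCluster ω x) ⊆ (⋃ x ∈ X, openEdgeCluster ω' x) → ω ∈ W → ω' ∈ W) :
    (prodBernoulli w).real ({ω : BondConfig V | ∀ s ∈ S, ∀ x ∈ X, ¬ (openGraph ω).Reachable s x} ∩ (𝒜 ∩ W)) ≤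
      (prodBernoulli w).real W *
        (prodBernoulli w).real ({ω : BondConfig V | ∀ s ∈ S, ∀ x ∈ X, ¬ (openGraph ω).Reachable s x} ∩ 𝒜) := by
  set μ := prodBernoulli w with hμ
  set DX : Set (BondConfig V) := {ω | ∀ s ∈ S, ∀ x ∈ X, ¬ (openGraph ω).Reachable s x} with hDX
  have uW : IsUpperSet W := FrontierDecRows.isUpperSet_of_clusterMono X hWX
  have lX : IsLowerSet DX := isLowerSet_notConn S X
  have m : ∀ A : Set (BondConfig V), MeasurableSet A := fun _ => MeasurableSet.of_discrete
  have h1 : μ.real (DX ∩ (𝒜 ∩ W)) * μ.real DX ≤ μ.real (DX ∩ 𝒜) * μ.real (DX ∩ W) := negCorr_sets w S X h𝒜 hWX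
  have h4a : μ.real (DX ∩ W) ≤ μ.real W * μ.real DX := by
    rw [inter_comm]; exact prodBernoulli_harris_upper_lower w uW lX (m _) (m _)
  have hL1d : μ.real (DX ∩ (𝒜 ∩ W)) ≤ μ.real DX := measureReal_mono inter_subset_left
  have n1 : 0 ≤ μ.real (DX ∩ (𝒜 ∩ W)) := measureReal_nonneg
  have n2 : 0 ≤ μ.real (DX ∩ 𝒜) := measureReal_nonneg
  have n3 : 0 ≤ μ.real W := measureReal_nonneg
  rcases eq_or_lt_of_le (measureReal_nonneg : 0 ≤ μ.real DX) with h0 | hp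
  · have : μ.real (DX ∩ (𝒜 ∩ W)) = 0 := le_antisymm (h0 ▸ hL1d) n1
    rw [this]; exact mul_nonneg n3 n2
  · have : μ.real (DX ∩ (𝒜 ∩ W)) * μ.real DX ≤ (μ.real W * μ.real (DX ∩ 𝒜)) * μ.real DX :=
      calc μ.real (DX ∩ (𝒜 ∩ W)) * μ.real DX ≤ μ.real (DX ∩ 𝒜) * μ.real (DX ∩ W) := h1
        _ ≤ μ.real (DX ∩ 𝒜) * (μ.real W * μ.real DX) := mul_le_mul_of_nonneg_left h4a n2
        _ = (μ.real W * μ.real (DX ∩ 𝒜)) * μ.real DX := by ring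
    exact le_of_mul_le_mul_right this hp

/-- **Set form of the row dR4⁺** (`PivotalBHK.dualRowR4_PrW`, part VII): for `𝒜` closed under enlarging `C_S`, `W` closed under
enlarging `C_X` and ANY increasing event `ℰ`:  `μ({S↮X} ∩ (𝒜 ∩ W)) · μ(ℰ) ≤ μ({S↮X} ∩ 𝒜) · μ(W ∩ ℰ)`, i.e.
`P(W | 𝒜, S ↮ X) ≤ P(W) ≤ P(W | ℰ)`. [this work] -/
theorem condDR4 {𝒜 W ℰ : Set (BondConfig V)}
    (h𝒜 : ∀ ⦃ω ω' : BondConfig V⦄, (⋃ s ∈ S, openEdgeCluster ω s) ⊆ (⋃ s ∈ S, openEdgeCluster ω' s) → ω ∈ 𝒜 → ω' ∈ 𝒜)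
    (hWX : ∀ ⦃ω ω' : BondConfig V⦄, (⋃ x ∈ X, openEdgeCluster ω x) ⊆ (⋃ x ∈ X, openEdgeCluster ω' x) → ω ∈ W → ω' ∈ W)
    (hℰ : IsUpperSet ℰ) :
    (prodBernoulli w).real ({ω : BondConfig V | ∀ s ∈ S, ∀ x ∈ X, ¬ (openGraph ω).Reachable s x} ∩ (𝒜 ∩ W)) *
        (prodBernoulli w).real ℰ ≤
      (prodBernoulli w).real ({ω : BondConfig V | ∀ s ∈ S, ∀ x ∈ X, ¬ (openGraph ω).Reachable s x} ∩ 𝒜) *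
        (prodBernoulli w).real (W ∩ ℰ) := by
  have uW : IsUpperSet W := FrontierDecRows.isUpperSet_of_clusterMono X hWX
  have m : ∀ A : Set (BondConfig V), MeasurableSet A := fun _ => MeasurableSet.of_discrete
  have h1 := negCorr_of_condBHK w S X h𝒜 hWX
  have h2 : (prodBernoulli w).real W * (prodBernoulli w).real ℰ ≤ (prodBernoulli w).real (W ∩ ℰ) :=
    prodBernoulli_harris w uW hℰ (m _) (m _)
  have n2 : 0 ≤ (prodBernoulli w).real ({ω : BondConfig V | ∀ s ∈ S, ∀ x ∈ X, ¬ (openGraph ω).Reachable s x} ∩ 𝒜) :=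
    measureReal_nonneg
  calc (prodBernoulli w).real ({ω : BondConfig V | ∀ s ∈ S, ∀ x ∈ X, ¬ (openGraph ω).Reachable s x} ∩ (𝒜 ∩ W)) *
        (prodBernoulli w).real ℰ
      ≤ ((prodBernoulli w).real W *
          (prodBernoulli w).real ({ω : BondConfig V | ∀ s ∈ S, ∀ x ∈ X, ¬ (openGraph ω).Reachable s x} ∩ 𝒜)) *
          (prodBernoulli w).real ℰ := mul_le_mul_of_nonneg_right h1 measureReal_nonneg
    _ = (prodBernoulli w).real ({ω : BondConfig V | ∀ s ∈ S, ∀ x ∈ X, ¬ (openGraph ω).Reachable s x} ∩ 𝒜) *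
          ((prodBernoulli w).real W * (prodBernoulli w).real ℰ) := by ring
    _ ≤ _ := mul_le_mul_of_nonneg_left h2 n2

/-! ### dR3 for sets: given `{X ~ Y}`, `{S ~ X}` and `{S ~ Y}` are positively correlated -/

/-- **dR3\*, four-cell form**: with `W = {X ~ Y}`, `E = {S ~ X}`, `F = {S ~ Y}` (arbitrary vertex sets):
`μ(Eᶜ ∩ (F ∩ W)) · μ(Fᶜ ∩ (E ∩ W)) ≤ μ(W ∩ (F ∩ E)) · μ(Fᶜ ∩ (Eᶜ ∩ W))` — the instance `𝒜 = {S ~ Y}`, `ℬ = {S ~ X}` of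
`condBHK_conn`.  For three terminals and their pendant leaf sets this is the kernel row dR3 `T_a·T_b ≤ u_c·T₀`
(`PivotalBHK.dualRowR3_PrW`). [this work] -/
theorem dualRowR3_sets :
    (prodBernoulli w).real ((⋃ s ∈ S, ⋃ x ∈ X, (openConn s x : Set (BondConfig V)))ᶜ ∩
          ((⋃ s ∈ S, ⋃ y ∈ Y, openConn s y) ∩ ⋃ x ∈ X, ⋃ y ∈ Y, openConn x y)) *
        (prodBernoulli w).real ((⋃ s ∈ S, ⋃ y ∈ Y, (openConn s y : Set (BondConfig V)))ᶜ ∩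
          ((⋃ s ∈ S, ⋃ x ∈ X, openConn s x) ∩ ⋃ x ∈ X, ⋃ y ∈ Y, openConn x y)) ≤
      (prodBernoulli w).real ((⋃ x ∈ X, ⋃ y ∈ Y, openConn x y) ∩
          ((⋃ s ∈ S, ⋃ y ∈ Y, openConn s y) ∩ ⋃ s ∈ S, ⋃ x ∈ X, (openConn s x : Set (BondConfig V)))) *
        (prodBernoulli w).real ((⋃ s ∈ S, ⋃ y ∈ Y, (openConn s y : Set (BondConfig V)))ᶜ ∩
          ((⋃ s ∈ S, ⋃ x ∈ X, (openConn s x : Set (BondConfig V)))ᶜ ∩ ⋃ x ∈ X, ⋃ y ∈ Y, openConn x y)) := by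
  rw [compl_conn_eq S X, compl_conn_eq S Y]
  exact condBHK_conn w S X Y (conn_closed_left S Y) (conn_closed_left S X)

/-- **dR3\* — given `{X ~ Y}`, the events `{S ~ X}` and `{S ~ Y}` are positively correlated** (arbitrary vertex sets `S, X, Y`,
arbitrary edge weights): `μ(W ∩ {S~X}) · μ(W ∩ {S~Y}) ≤ μ(W) · μ(W ∩ ({S~X} ∩ {S~Y}))`, `W = {X ~ Y} = ⋃_{x∈X, y∈Y} {x ↔ y}`,
`{S ~ X} = ⋃_{s∈S, x∈X} {s ↔ x}`.  (For `X ∩ Y ≠ ∅`, `W` is everything and this is Harris; for singletons it is trivial; the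
content is disjoint sets.  Contrast [van den Berg–Kahn 2001, Remark after Thm. 1.1]: given `{s ~ t}`, `{s ~ a}` and `{s ~ b}` are in
general NOT positively correlated.)  From the four-cell form by `(p+x)(p+y) ≤ p(p+x+y+q) ⟸ xy ≤ pq`. [this work] -/
theorem posCorr_conn_sets :
    (prodBernoulli w).real ((⋃ x ∈ X, ⋃ y ∈ Y, openConn x y) ∩ ⋃ s ∈ S, ⋃ x ∈ X, (openConn s x : Set (BondConfig V))) *
        (prodBernoulli w).real ((⋃ x ∈ X, ⋃ y ∈ Y, openConn x y) ∩ ⋃ s ∈ S, ⋃ y ∈ Y, (openConn s y : Set (BondConfig V))) ≤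
      (prodBernoulli w).real (⋃ x ∈ X, ⋃ y ∈ Y, (openConn x y : Set (BondConfig V))) *
        (prodBernoulli w).real ((⋃ x ∈ X, ⋃ y ∈ Y, openConn x y) ∩
          ((⋃ s ∈ S, ⋃ x ∈ X, (openConn s x : Set (BondConfig V))) ∩ ⋃ s ∈ S, ⋃ y ∈ Y, openConn s y)) := by
  set μ := prodBernoulli w with hμ
  set W : Set (BondConfig V) := ⋃ x ∈ X, ⋃ y ∈ Y, openConn x y with hW
  set E : Set (BondConfig V) := ⋃ s ∈ S, ⋃ x ∈ X, openConn s x with hE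
  set F : Set (BondConfig V) := ⋃ s ∈ S, ⋃ y ∈ Y, openConn s y with hF
  have key : μ.real (Eᶜ ∩ (F ∩ W)) * μ.real (Fᶜ ∩ (E ∩ W)) ≤ μ.real (W ∩ (F ∩ E)) * μ.real (Fᶜ ∩ (Eᶜ ∩ W)) :=
    dualRowR3_sets w S X Y
  have m : ∀ A : Set (BondConfig V), MeasurableSet A := fun _ => MeasurableSet.of_discrete
  -- the four cells of `W`
  have e1 : (W ∩ E) ∩ F = W ∩ (E ∩ F) := inter_assoc W E F
  have e2 : (W ∩ E) \ F = Fᶜ ∩ (E ∩ W) := by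
    ext ω; simp only [mem_sdiff, mem_inter_iff, mem_compl_iff]; tauto
  have e3 : (W ∩ F) ∩ E = W ∩ (E ∩ F) := by
    ext ω; simp only [mem_inter_iff]; tauto
  have e4 : (W ∩ F) \ E = Eᶜ ∩ (F ∩ W) := by
    ext ω; simp only [mem_sdiff, mem_inter_iff, mem_compl_iff]; tauto
  have e5 : (W \ E) ∩ F = Eᶜ ∩ (F ∩ W) := by
    ext ω; simp only [mem_sdiff, mem_inter_iff, mem_compl_iff]; tauto
  have e6 : (W \ E) \ F = Fᶜ ∩ (Eᶜ ∩ W) := by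
    ext ω; simp only [mem_sdiff, mem_inter_iff, mem_compl_iff]; tauto
  have sE : μ.real (W ∩ E) = μ.real (W ∩ (E ∩ F)) + μ.real (Fᶜ ∩ (E ∩ W)) := by
    rw [← measureReal_inter_add_sdiff (s := W ∩ E) (m F) (measure_ne_top _ _), e1, e2]
  have sF : μ.real (W ∩ F) = μ.real (W ∩ (E ∩ F)) + μ.real (Eᶜ ∩ (F ∩ W)) := by
    rw [← measureReal_inter_add_sdiff (s := W ∩ F) (m E) (measure_ne_top _ _), e3, e4]
  have sW : μ.real W = μ.real (W ∩ E) + (μ.real (Eᶜ ∩ (F ∩ W)) + μ.real (Fᶜ ∩ (Eᶜ ∩ W))) := by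
    rw [← measureReal_inter_add_sdiff (s := W) (m E) (measure_ne_top _ _),
      ← measureReal_inter_add_sdiff (s := W \ E) (m F) (measure_ne_top _ _), e5, e6]
  have eFE : W ∩ (F ∩ E) = W ∩ (E ∩ F) := by rw [inter_comm F E]
  rw [eFE] at key
  rw [sE, sF, sW, sE]
  have n1 : 0 ≤ μ.real (W ∩ (E ∩ F)) := measureReal_nonneg
  have n2 : 0 ≤ μ.real (Fᶜ ∩ (E ∩ W)) := measureReal_nonneg
  have n3 : 0 ≤ μ.real (Eᶜ ∩ (F ∩ W)) := measureReal_nonneg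
  have n4 : 0 ≤ μ.real (Fᶜ ∩ (Eᶜ ∩ W)) := measureReal_nonneg
  nlinarith [key, mul_nonneg n1 n1, mul_nonneg n1 n2, mul_nonneg n1 n3, mul_nonneg n1 n4]

end Main

end ConditionedBHK

end Summit.CriticalPhenomena.PercolationContinuityZ3.Theorems

end
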